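import Summits.CriticalPhenomena.Ising3DConformalLimit.Theorems.PlantedPinningMoebiusLimitExistsWardDoor
import Summits.CriticalPhenomena.Ising3DConformalLimit.Theorems.PlantedPinningMoebiusLimitExistsWeakTranslation
import Summits.CriticalPhenomena.Ising3DConformalLimit.Theorems.PlantedPinningMoebiusLimitExistsWardOnU0
import Summits.CriticalPhenomena.Ising3DConformalLimit.Theorems.PlantedPinningMoebiusLimitExistsWardOfWardOnU0
import Summits.CriticalPhenomena.Ising3DConformalLimit.Theorems.MoebiusLimitExists.Negative.InversionContent
import Summits.CriticalPhenomena.Ising3DConformalLimit.Theorems.MoebiusLimitExists.Negative.MeshContinuity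
import Summits.CriticalPhenomena.Ising3DConformalLimit.Theorems.InversionUpgradeNormalised.Negative.AutomaticOrders
import Literature.Probability.LatticeModels.SCTWardIdentity
import HarnessLib

/-!
# Stub W0 `stub_wardLowLevels` for crux `MoebiusLimitExists` (stmt-CriticalPhenomena-1344), line `Sketch` v11
(lead prover-line-stmt-CriticalPhenomena-1344-c17-0; THEOREM-ONLY, `--supports stmt-CriticalPhenomena-1344`)

**Levels `n < 4` and odd levels of the weak special-conformal Ward identities are free** for every normalised
Euclidean-invariant scale-covariant pointwise scaling limit `S` of the critical `ℤ³` Ising correlators: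
* odd `n`: `S n ≡ 0` (landed `InversionUpgradeNormalisedNegative.limit_odd_eq_zero`),
  so `SCTWardWeak.of_forall_eq_zero` applies;
* `n = 0`: `Fin 0 → ℝ³` is a one-point space, every test function is constant, its `fderiv` vanishes and `Σ_{i : Fin 0} = 0`,
  so the Ward integrand is identically zero;
* `n = 2`: the two-point function is inversion covariant with weight `Δ` at configurations avoiding the origin
  (`MoebiusLimitExistsNegative.inversion_two_of_covariantLimit` on `NonCoincident`; both sides vanish off it by normalisation,
  the inversion being injective), hence the weak Ward identity at level 2 by the landed level-wise converse
  `stub_wardOfWardOnU0 2 ∘ stub_wardOnU0 2 ∘ stub_weakTranslation 2` (continuity off the diagonals: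
  `LimitMeshContinuity.continuousOn_limit`; translations: `IsEuclideanInvariant.1`), folded by `sctWardWeak_three_iff`.

References: Di Francesco–Mathieu–Sénéchal, *Conformal Field Theory* (1997) §4.3.1 (4.51)–(4.55). No definitions are introduced.
-/

noncomputable section

open Filter Topology MeasureTheory
open Literature.Probability.LatticeModels
open EuclideanGeometry
open Summit.CriticalPhenomena.Ising3DConformalLimit.MoebiusLimitExistsSketchV9
  (stub_weakTranslation stub_wardOnU0 stub_wardOfWardOnU0)
open Summit.CriticalPhenomena.Ising3DConformalLimit.MoebiusLimitExistsWardDoor (sctWardWeak_three_iff)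

namespace Summit.CriticalPhenomena.Ising3DConformalLimit.MoebiusLimitExistsSketchV11

/-! ### Bookkeeping: the normalised family off the diagonals -/

/-- The unit inversion preserves (non-)coincidence of configurations (it is injective). [folklore] -/
theorem inversion_mem_nonCoincident_iff {n : ℕ} (x : Fin n → EuclideanSpace ℝ (Fin 3)) :
    (fun i => inversion (0 : EuclideanSpace ℝ (Fin 3)) 1 (x i)) ∈ NonCoincident 3 n ↔
      x ∈ NonCoincident 3 n := by
  rw [mem_nonCoincident, mem_nonCoincident]
  exact (inversion_injective _ one_ne_zero).of_comp_iff x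

/-- **Inversion covariance of `S₂` at every configuration avoiding the origin** for a normalised `O(3)`-invariant
scale-covariant pointwise limit (`inversion_two_of_covariantLimit` on `NonCoincident`; both sides vanish off it).
[cite: FrancescoMathieuSenechal1997, §4.3.1 eq. (4.55)] -/
theorem inversion_two_normalised {ρ : ℝ → ℝ} {Δ : ℝ} {S : CorrFamily 3}
    (hlim : HasPointwiseScalingLimit (criticalCorr 3) ρ S) (hnorm : ∀ n z, z ∉ NonCoincident 3 n → S n z = 0)
    (hrot : IsRotationInvariant S) (hsc : IsScaleCovariant Δ S)
    (x : Fin 2 → EuclideanSpace ℝ (Fin 3)) (hx0 : ∀ i, x i ≠ 0) :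
    S 2 (fun i => inversion 0 1 (x i)) = (∏ i, ‖x i‖ ^ (2 * Δ)) * S 2 x := by
  by_cases hx : x ∈ NonCoincident 3 2
  · exact MoebiusLimitExistsNegative.inversion_two_of_covariantLimit hlim hrot hsc x hx0 hx
  · rw [hnorm 2 _ (mt (inversion_mem_nonCoincident_iff x).1 hx), hnorm 2 x hx, mul_zero]

/-! ### Level `0`: the configuration space is a point -/

/-- **The weak Ward identity at level `0` is void**: `Fin 0 → ℝ³` is a one-point space, so every test function has
zero derivative and the (empty) moment sum vanishes. [folklore] -/
theorem sctWardWeak_zero (S : CorrFamily 3) (Δ : ℝ) : SCTWardWeak S Δ 0 := by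
  intro b φ _ _ _
  have h : ∀ x : Fin 0 → EuclideanSpace ℝ (Fin 3), fderiv ℝ φ x = 0 := fun x =>
    (hasFDerivAt_of_subsingleton φ x).fderiv
  simp [h]

/-! ### The stub -/

/-- **Stub W0 — `stub_wardLowLevels`** (registered signature): for every normalised Euclidean-invariant scale-covariant
pointwise scaling limit of the critical `ℤ³` correlators, `SCTWardWeak S Δ n` holds for `n < 4` and for all odd `n`
(odd: `S n ≡ 0`; `n = 0`: `sctWardWeak_zero`; `n = 2`: inversion covariance of `S₂` and the level-wise converse
`stub_wardOfWardOnU0 2 ∘ stub_wardOnU0 2 ∘ stub_weakTranslation 2`, folded by `sctWardWeak_three_iff`).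
[cite: FrancescoMathieuSenechal1997, §4.3.1 (4.51)–(4.55)] -/
theorem stub_wardLowLevels :
    ∀ (ρ : ℝ → ℝ) (Δ : ℝ) (S : CorrFamily 3),
      HasPointwiseScalingLimit (criticalCorr 3) ρ S → (∀ n z, z ∉ NonCoincident 3 n → S n z = 0) →
      IsEuclideanInvariant S → IsScaleCovariant Δ S →
      ∀ n, n < 4 ∨ Odd n → SCTWardWeak S Δ n := by
  intro ρ Δ S hlim hnorm heuc hsc n hn
  have hodd : Odd n → SCTWardWeak S Δ n := fun ho =>
    SCTWardWeak.of_forall_eq_zero (fun x => InversionUpgradeNormalisedNegative.limit_odd_eq_zero hlim hnorm ho x) Δ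
  rcases hn with hlt | ho
  swap
  · exact hodd ho
  interval_cases n
  · exact sctWardWeak_zero S Δ
  · exact hodd (by decide)
  · have hcont : ContinuousOn (S 2) (NonCoincident 3 2) :=
      MoebiusLimitExistsWardDoor.continuousOn_of_limit hlim 2
    have htr : ∀ (v : EuclideanSpace ℝ (Fin 3)) (x : Fin 2 → EuclideanSpace ℝ (Fin 3)),
        S 2 (fun i => x i + v) = S 2 x := heuc.1 2
    exact (sctWardWeak_three_iff S Δ 2).2
      (stub_wardOfWardOnU0 2 (S 2) Δ hcont htr
        (stub_wardOnU0 2 (S 2) Δ hcont (inversion_two_normalised hlim hnorm heuc.2 hsc)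
          (stub_weakTranslation 2 (S 2) hcont htr)))
  · exact hodd (by decide)

end Summit.CriticalPhenomena.Ising3DConformalLimit.MoebiusLimitExistsSketchV11

end
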